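import Summits.RiemannHypothesis.RiemannHypothesis.Theorems.Splittings.RobinFiniteE1cTheta
import Summits.RiemannHypothesis.RiemannHypothesis.Theorems.Splittings.RobinFiniteE1cExplicitFormula
import HarnessLib

/-!
# Splittings — Robin finite lens, E1c⁻ part 4/4: the PARTIAL-RH lower Nicolas inequality (2.18), PROVED modulo two RH-free
# named `θ`-facts; headlines at the Platt–Trudgian height; windowed consumers (SPLIT-robin-finite gen 5; zero-def raw form)

Cell rh-split, seat rh-split-robin-finite g5 (brief sha16 f79c5f09d8bcb036), card
`run/shared/lean/pub/rh-split/cards/SPLIT-robin-finite.md` §12; zero-definition raw form of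
`HOME/rh-split-robin-finite/SketchG5-E1c.lean` (sha16 a141f2e32dd4cace; referee CONTENT REPLAY PASS rh-split-ref g2
2026-08-27T03:02:44Z: farm rc 0 / 0 warn / 0 sorry, std axioms on `E1c.partialNicolasLower_PT`,
`E1c.nicolasLowerBetween_PT`, `E1c.schoenfeldThetaOn_of_buthe2016`), filed by rh-split-typer-1 g4.  The scratch's 15
interface `def`s (`nicolasEWith`, `SchoenfeldThetaOn`, `OffLineSumAt`, `budgetPw`, `PartialExplicitCorePwLower`,
`ExplicitFormulaFree`, `ZeroSplitBound`, `PsiSubThetaFree`, `termSum`, `OffLineSumOn`, `NicolasLowerBetween`,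
`PartialNicolasBetween`, `ZeroTailBound`, `lehmanH`, `lehmanTail`) are SPELLED OUT VERBATIM at every site; proofs are the
scratch's, with only the `unfold`/`rw` steps of the spelled-out abbreviations removed.
Not carried: the g4 interface lemmas `offLineSumAt_mono`, `schoenfeldThetaOn_anti`, `nicolasLowerBetween_mono` (one-line
monotonicities of the spelled-out abbreviations; the two that are used are inlined as terms) and the named-fact candidates
`lehmanH` / `lehmanTail` (no theorem of the scratch uses them).
HONEST LABEL: «SPLITTING SEARCH over kernel-typed RH-EQUIVALENCES; a splitting A ∧ B ⟹ RH is CONDITIONAL bookkeeping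
unless A and B are both proved; nothing here bears on the truth of RH.»

E1c⁻ = the LOWER (load-bearing) half of g4's pointwise core `PartialExplicitCorePw` (card §11): «RH up to height `T` +
Schoenfeld's `θ`-window at `x` + a bound `D` on the weighted zero sum above height `T` ⟹ Nicolas's lower inequality (2.18)
at `x` with zero budget `0.0463 + 2(1 + 2/log x)D` in place of `β`».  PROVED here (`corePwLower`, std axioms) from the two
RH-FREE named facts `Buthe2018_thm2_theta` [Büthe 2018 Thm 2], `BroadbentEtAl2021_theta_rel_1e19` [BKLNW 2021 §1.2] and
nothing else: the composition `corePwLower_of_stubs` is `Lemma24RH.logf_lowerRH` re-read — Lemma 2.1 lower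
(`NicolasK.lemma21_lower`, RH-free) + the local `θ`-terms from the window (part 1) + Cor. 2.1 in the limit form
(`jk_partial_le` + `NicolasK.tendsto_integral_S_mul_w0`, RH-free — NO `|R₁| ≤ Ct^{3/2}` majorant) + S1 (part 3) + S2 (part 2)
+ `Fhalf_le`/`Fthird_le`.
HEADLINES: `partialNicolasLower` (general `T`, window hypothesis explicit); `partialNicolasLower_le19` (Büthe 2018: window ←
the fixed finite check on `[599, 1423]`, `x ≤ 10¹⁹`); `partialNicolasLower_PT` — with RH verified to `3 000 175 332 800`
(Platt–Trudgian 2021, the tree's `RiemannHypothesisUpTo`) + `Buthe2016_thm2` the window is DISCHARGED for every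
`x ≤ 2.169·10²⁵`, so for `599 ≤ x ≤ 2.169·10²⁵` the unverified zeros enter ONLY through the one number
`D ≥ Σ_{|γ|>3·10¹²} m x^{β−1/2}/γ²`.
DOWNSTREAM (g5-d): g4's windowed consumer fed by the proved lower core (`partialNicolasBetween_holds`,
`partialNicolasBetween_of_tail`), and at the Platt–Trudgian height `nicolasLowerBetween_PT : Buthe2016_thm2 →
Buthe2018_thm2_theta → BroadbentEtAl2021_theta_rel_1e19 → RiemannHypothesisUpTo 3000175332800 → (Σ_{|γ|>T} m/γ² ≤ h) →
0 ≤ h → 1 < X₀ → X₁ ≤ 2.169e25 →` Nicolas's lower bound with budget `0.0463 + 2(1 + 2/log X₀)·h·√X₁` on `[X₀, X₁]`.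
All theorems: `RiemannHypothesisUpTo` / the named facts in HYPOTHESIS position; nothing here is a claim about RH.
-/

set_option linter.dupNamespace false

noncomputable section

open Complex Filter Set MeasureTheory Topology intervalIntegral
open scoped Real Chebyshev ComplexConjugate

namespace Summit.RiemannHypothesis.RiemannHypothesis.Theorems.Splittings.RobinFiniteE1c

open Literature.NumberTheory.LFunctions Literature.NumberTheory.DiophantineGeometry
open NicolasJ NicolasFz NicolasK NicolasJExplicit

/-! ### The composition (kernel-checked): S1 ∧ S2 ∧ (global `ψ − θ`) ⟹ E1c⁻ -/

/-- **E1c⁻ from the stubs** (scratch `corePwLower_of_stubs : ExplicitFormulaFree → ZeroSplitBound → (ψ − θ bound) →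
PartialExplicitCorePwLower`, all four spelled out).  The proof is `Lemma24RH.logf_lowerRH` re-read: Lemma 2.1 lower
(`NicolasK.lemma21_lower`, RH-free) + the local `θ`-terms from the window + Cor. 2.1 in the limit form
(`jk_partial_le` + `NicolasK.tendsto_integral_S_mul_w0`, RH-free — NO `|R₁| ≤ Ct^{3/2}` majorant needed) +
S1 + S2 + `Fhalf_le`/`Fthird_le`; the budget `0.0463 + 2(1 + 2/log x)D` dominates the produced
`0.0463·(a₁ + a₂ + 4a₃) + (1 + 2/log x)·D·a₁`. -/
theorem corePwLower_of_stubs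
    (h1 : ∀ x : ℝ, 1 < x →
      Summable (fun ρ : Zeros ↦ (riemannZetaZeroOrder (ρ : ℂ) : ℂ) / (ρ : ℂ) * Fz (ρ : ℂ) x) ∧
      ∃ L : ℝ, Tendsto (fun X : ℝ ↦ ∫ t in x..X, (ψ t - t) * w0 t) atTop (𝓝 L) ∧
        (-∑' ρ : Zeros, (riemannZetaZeroOrder (ρ : ℂ) : ℂ) / (ρ : ℂ) * Fz (ρ : ℂ) x).re
          - Real.log (2 * π) / (x * Real.log x) ≤ L)
    (h2 : ∀ T x D : ℝ, 1 < x → RiemannHypothesisUpTo T →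
      (∑' ρ : RHWave0.riemannZetaNontrivialZeros,
        (if T < |(ρ : ℂ).im| then
          (riemannZetaZeroOrder (ρ : ℂ) : ℝ) * x ^ ((ρ : ℂ).re - 1 / 2) / (ρ : ℂ).im ^ 2 else 0) ≤ D) →
      Summable (fun ρ : Zeros ↦ (riemannZetaZeroOrder (ρ : ℂ) : ℂ) / (ρ : ℂ) * Fz (ρ : ℂ) x) →
        -(0.0463 * (1 / (Real.sqrt x * Real.log x) + Dx x)
            + (1 + 2 / Real.log x) * D * (1 / (Real.sqrt x * Real.log x))) ≤
          (-∑' ρ : Zeros, (riemannZetaZeroOrder (ρ : ℂ) : ℂ) / (ρ : ℂ) * Fz (ρ : ℂ) x).re)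
    (h4 : ∀ t : ℝ, 599 ≤ t → ψ t - θ t ≤ 1.021 * Real.sqrt t + 4 / 3 * t ^ ((1 : ℝ) / 3)) :
    ∀ T x D : ℝ, 599 ≤ x → 0 ≤ D → RiemannHypothesisUpTo T →
      (∀ y : ℝ, 599 ≤ y → y ≤ x → |θ y - y| ≤ √y * Real.log y ^ 2 / (8 * π)) →
      (∑' ρ : RHWave0.riemannZetaNontrivialZeros,
        (if T < |(ρ : ℂ).im| then
          (riemannZetaZeroOrder (ρ : ℂ) : ℝ) * x ^ ((ρ : ℂ).re - 1 / 2) / (ρ : ℂ).im ^ 2 else 0) ≤ D) →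
      -Real.log (nicolasF x) ≤ RobinAnalyticSharp.nicolasERH x +
        (0.0463 + 2 * (1 + 2 / Real.log x) * D - nicolasBeta) *
          (1 / (√x * Real.log x) + 1 / (√x * Real.log x ^ 2) + 4 / (√x * Real.log x ^ 3)) := by
  intro T x D hx hD hT hW hoff
  have hx1 : (1 : ℝ) < x := by linarith
  have hx0 : (0 : ℝ) < x := by linarith
  have hlx : 0 < Real.log x := Real.log_pos hx1
  have hsx : 0 < Real.sqrt x := Real.sqrt_pos.2 hx0
  -- Lemma 2.1 lower and the local θ-terms (window)
  have h21 := NicolasK.lemma21_lower (by linarith : (121 : ℝ) ≤ x) (theta_ge_four_fifths_of_window hW hx)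
  have hS2 := sq_theta_sub_div_le_of_window hW hx
  -- S1: the RH-free explicit formula in limit form
  obtain ⟨hsum, L, hL, hZL⟩ := h1 x hx1
  -- Cor. 2.1 in the limit: L − K ≤ 1.021 F_{1/2} + (4/3) F_{1/3}
  have hK := NicolasK.tendsto_integral_S_mul_w0 hx1
  have hJK : L - nicolasKInt x ≤ 1.021 * (Fz (1 / 2 : ℝ) x).re + 4 / 3 * (Fz (1 / 3 : ℝ) x).re := by
    refine le_of_tendsto (hL.sub hK) ?_
    filter_upwards [eventually_ge_atTop x] with X hX
    exact jk_partial_le hx1 hX (by norm_num) fun t ht ↦ h4 t (le_trans hx ht)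
  -- S2: the zero split under RH(T)
  have hZ := h2 T x D hx1 hT hoff hsum
  -- F bounds
  have hF2 := NicolasFz.Fhalf_le hx1
  have hF3 := NicolasFz.Fthird_le hx1
  -- bookkeeping
  obtain ⟨a₁, ha₁⟩ : ∃ a : ℝ, a = 1 / (Real.sqrt x * Real.log x) := ⟨_, rfl⟩
  obtain ⟨a₂, ha₂⟩ : ∃ a : ℝ, a = 1 / (Real.sqrt x * Real.log x ^ 2) := ⟨_, rfl⟩
  obtain ⟨a₃, ha₃⟩ : ∃ a : ℝ, a = 1 / (Real.sqrt x * Real.log x ^ 3) := ⟨_, rfl⟩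
  obtain ⟨a₅, ha₅⟩ : ∃ a : ℝ, a = 1 / (x ^ ((2 : ℝ) / 3) * Real.log x) := ⟨_, rfl⟩
  obtain ⟨P, hP⟩ : ∃ a : ℝ, a = (1 + 2 / Real.log x) * D := ⟨_, rfl⟩
  have hP0 : 0 ≤ P := by rw [hP]; positivity
  have ha₁0 : 0 ≤ a₁ := by rw [ha₁]; positivity
  have ha₂0 : 0 ≤ a₂ := by rw [ha₂]; positivity
  have ha₃0 : 0 ≤ a₃ := by rw [ha₃]; positivity
  have hPa₁ : 0 ≤ P * a₁ := mul_nonneg hP0 ha₁0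
  have hPa₂ : 0 ≤ P * a₂ := mul_nonneg hP0 ha₂0
  have hPa₃ : 0 ≤ P * a₃ := mul_nonneg hP0 ha₃0
  have eZ : -(0.0463 * (1 / (Real.sqrt x * Real.log x) + Dx x)
      + (1 + 2 / Real.log x) * D * (1 / (Real.sqrt x * Real.log x))) =
      -0.0463 * a₁ - 0.0463 * a₂ - 0.1852 * a₃ - P * a₁ := by
    rw [ha₁, ha₂, ha₃, hP, NicolasJExplicit.Dx]
    field_simp
    ring
  have eF2 : 2 / (Real.sqrt x * Real.log x) - 2 / (Real.sqrt x * Real.log x ^ 2) +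
      8 / (Real.sqrt x * Real.log x ^ 3) = 2 * a₁ - 2 * a₂ + 8 * a₃ := by
    rw [ha₁, ha₂, ha₃]; ring
  have eF3 : 3 / (2 * x ^ (2 / 3 : ℝ) * Real.log x) = 3 / 2 * a₅ := by
    rw [ha₅]; ring
  have eE : RobinAnalyticSharp.nicolasERH x +
        (0.0463 + 2 * (1 + 2 / Real.log x) * D - nicolasBeta) *
          (1 / (√x * Real.log x) + 1 / (√x * Real.log x ^ 2) + 4 / (√x * Real.log x ^ 3)) =
      2.0883 * a₁ + 2 * (P * a₁) - 1.9957 * a₂ + 2 * (P * a₂) + 8.3532 * a₃ + 8 * (P * a₃)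
        + Real.log (2 * π) / (x * Real.log x) + 2 * a₅ + Real.log x ^ 3 / (64 * π ^ 2 * x) := by
    rw [ha₁, ha₂, ha₃, ha₅, hP]
    unfold RobinAnalyticSharp.nicolasERH RobinAnalyticSharp.nicolasE
    ring
  rw [eZ] at hZ
  rw [eF2] at hF2
  rw [eF3] at hF3
  rw [eE]
  linarith

/-- **E1c⁻ modulo the two RH-free named `θ`-facts** (Büthe 2018 Thm 2; BKLNW 2021 §1.2): scratch
`E1c.corePwLower : PartialExplicitCorePwLower`, spelled out. -/
theorem corePwLower (hB : Buthe2018_thm2_theta) (hK : BroadbentEtAl2021_theta_rel_1e19) :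
    ∀ T x D : ℝ, 599 ≤ x → 0 ≤ D → RiemannHypothesisUpTo T →
      (∀ y : ℝ, 599 ≤ y → y ≤ x → |θ y - y| ≤ √y * Real.log y ^ 2 / (8 * π)) →
      (∑' ρ : RHWave0.riemannZetaNontrivialZeros,
        (if T < |(ρ : ℂ).im| then
          (riemannZetaZeroOrder (ρ : ℂ) : ℝ) * x ^ ((ρ : ℂ).re - 1 / 2) / (ρ : ℂ).im ^ 2 else 0) ≤ D) →
      -Real.log (nicolasF x) ≤ RobinAnalyticSharp.nicolasERH x +
        (0.0463 + 2 * (1 + 2 / Real.log x) * D - nicolasBeta) *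
          (1 / (√x * Real.log x) + 1 / (√x * Real.log x ^ 2) + 4 / (√x * Real.log x ^ 3)) :=
  corePwLower_of_stubs explicitFormulaFree_holds zeroSplitBound_holds (psiSubThetaFree_holds hB hK)

/-- **Headline (g5)**: the partial-RH lower Nicolas inequality, RH-free apart from `RiemannHypothesisUpTo T`.
For `x ≥ 599`, `D ≥ 0`: RH up to height `T`, Schoenfeld's `θ`-bound on `[599, x]` and
`Σ_{|γ|>T} m(ρ) x^{Re ρ − 1/2}/γ² ≤ D` give `−log f(x) ≤ E(0.0463 + 2(1 + 2/log x)D, x)` (Nicolas 2012 (2.18) with the zero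
budget `β` replaced by `0.0463 + 2(1 + 2/log x)D`).  Inputs: Büthe 2018 Thm 2, Broadbent et al. 2021 §1.2 (both RH-free). -/
theorem partialNicolasLower (hB : Buthe2018_thm2_theta) (hK : BroadbentEtAl2021_theta_rel_1e19)
    {T x D : ℝ} (hx : 599 ≤ x) (hD : 0 ≤ D) (hT : RiemannHypothesisUpTo T)
    (hθ : ∀ y : ℝ, 599 ≤ y → y ≤ x → |θ y - y| ≤ √y * Real.log y ^ 2 / (8 * π))
    (hoff : ∑' ρ : RHWave0.riemannZetaNontrivialZeros,
        (if T < |(ρ : ℂ).im| then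
          (riemannZetaZeroOrder (ρ : ℂ) : ℝ) * x ^ ((ρ : ℂ).re - 1 / 2) / (ρ : ℂ).im ^ 2 else 0) ≤ D) :
    -Real.log (nicolasF x) ≤ RobinAnalyticSharp.nicolasERH x +
        (0.0463 + 2 * (1 + 2 / Real.log x) * D - nicolasBeta) * (1 / (√x * Real.log x) + 1 / (√x * Real.log x ^ 2) + 4 / (√x * Real.log x ^ 3)) :=
  corePwLower hB hK T x D hx hD hT hθ hoff

/-- **Headline below `10¹⁹`**: for `599 ≤ x ≤ 10¹⁹` the window is Büthe's theorem plus the fixed finite check on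
`[599, 1423]`; the only non-finite, non-literature hypothesis left is `RiemannHypothesisUpTo T`. -/
theorem partialNicolasLower_le19 (hB : Buthe2018_thm2_theta) (hK : BroadbentEtAl2021_theta_rel_1e19)
    (h0 : ∀ y : ℝ, 599 ≤ y → y ≤ 1423 → |θ y - y| ≤ √y * Real.log y ^ 2 / (8 * π))
    {T x D : ℝ} (hx : 599 ≤ x) (hx19 : x ≤ (10 : ℝ) ^ 19) (hD : 0 ≤ D) (hT : RiemannHypothesisUpTo T)
    (hoff : ∑' ρ : RHWave0.riemannZetaNontrivialZeros,
        (if T < |(ρ : ℂ).im| then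
          (riemannZetaZeroOrder (ρ : ℂ) : ℝ) * x ^ ((ρ : ℂ).re - 1 / 2) / (ρ : ℂ).im ^ 2 else 0) ≤ D) :
    -Real.log (nicolasF x) ≤ RobinAnalyticSharp.nicolasERH x +
        (0.0463 + 2 * (1 + 2 / Real.log x) * D - nicolasBeta) * (1 / (√x * Real.log x) + 1 / (√x * Real.log x ^ 2) + 4 / (√x * Real.log x ^ 3)) :=
  corePwLower hB hK T x D hx hD hT (schoenfeldThetaOn_of_buthe hB h0 hx19) hoff

/-- **Headline (g5, Platt–Trudgian range)**: with RH verified to height `3 000 175 332 800` (Platt–Trudgian 2021,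
Thm 1 — the tree's `RiemannHypothesisUpTo`), Büthe 2016 Thm 2, Büthe 2018 Thm 2 and Broadbent–Kadiri–Lumley–Ng–Wilk
2021 (all RH-free named facts of the tree, in hypothesis position), for every `599 ≤ x ≤ 2.169·10²⁵` and every
`D ≥ Σ_{|γ| > 3·10¹²} m(ρ) x^{Re ρ − 1/2}/γ²`: `−log f(x) ≤ E(0.0463 + 2(1 + 2/log x)D, x)`.  The unverified zeros enter ONLY
through `D`. -/
theorem partialNicolasLower_PT (h16 : Buthe2016_thm2) (hB : Buthe2018_thm2_theta)
    (hK : BroadbentEtAl2021_theta_rel_1e19) (hRH : RiemannHypothesisUpTo 3000175332800)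
    {x D : ℝ} (hx : 599 ≤ x) (hx25 : x ≤ 2.169e25) (hD : 0 ≤ D)
    (hoff : ∑' ρ : RHWave0.riemannZetaNontrivialZeros,
        (if 3000175332800 < |(ρ : ℂ).im| then
          (riemannZetaZeroOrder (ρ : ℂ) : ℝ) * x ^ ((ρ : ℂ).re - 1 / 2) / (ρ : ℂ).im ^ 2 else 0) ≤ D) :
    -Real.log (nicolasF x) ≤ RobinAnalyticSharp.nicolasERH x +
        (0.0463 + 2 * (1 + 2 / Real.log x) * D - nicolasBeta) * (1 / (√x * Real.log x) + 1 / (√x * Real.log x ^ 2) + 4 / (√x * Real.log x ^ 3)) :=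
  corePwLower hB hK _ x D hx hD hRH (schoenfeldThetaOn_of_buthe2016 h16 hRH hx25) hoff

/-! ### (g5-d) Downstream: g4's windowed consumers fed by the PROVED lower core -/

/-- g4 · Nicolas's modified error with a variable zero budget is monotone in the budget (`x > 1`) (scratch
`nicolasEWith_mono`, `nicolasEWith` spelled out). -/
theorem nicolasEWith_mono {b b' x : ℝ} (hx : 1 < x) (hb : b ≤ b') :
    RobinAnalyticSharp.nicolasERH x +
        (b - nicolasBeta) * (1 / (√x * Real.log x) + 1 / (√x * Real.log x ^ 2) + 4 / (√x * Real.log x ^ 3)) ≤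
      RobinAnalyticSharp.nicolasERH x +
        (b' - nicolasBeta) * (1 / (√x * Real.log x) + 1 / (√x * Real.log x ^ 2) + 4 / (√x * Real.log x ^ 3)) := by
  have hlog : 0 < Real.log x := Real.log_pos hx
  have hs : 0 < √x := Real.sqrt_pos.2 (by linarith)
  have hnn : 0 ≤ 1 / (√x * Real.log x) + 1 / (√x * Real.log x ^ 2) + 4 / (√x * Real.log x ^ 3) := by
    positivity
  have key := mul_le_mul_of_nonneg_right (sub_le_sub_right hb nicolasBeta) hnn
  linarith

/-- g4 · the pointwise budget `0.0463 + 2(1 + 2/log x)D` decreases along the window (for `D ≥ 0`) (scratch `budgetPw_anti`,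
spelled out). -/
theorem budgetPw_anti {D X₀ x : ℝ} (hD : 0 ≤ D) (hX₀ : 1 < X₀) (hx : X₀ ≤ x) :
    0.0463 + 2 * (1 + 2 / Real.log x) * D ≤ 0.0463 + 2 * (1 + 2 / Real.log X₀) * D := by
  have h0 : 0 < Real.log X₀ := Real.log_pos hX₀
  have hle : Real.log X₀ ≤ Real.log x := Real.log_le_log (by linarith) hx
  have h2 : 2 / Real.log x ≤ 2 / Real.log X₀ := div_le_div_of_nonneg_left (by norm_num) h0 hle
  have h3 : 2 / Real.log x * D ≤ 2 / Real.log X₀ * D := mul_le_mul_of_nonneg_right h2 hD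
  linarith

/-- g4 · the tail series `Σ_{|Im ρ|>T} m(ρ)/(Im ρ)²` is summable — comparison with Ford's `Σ m(ρ)/|ρ|²`
(`|ρ|² = β² + γ² ≤ 2γ²` since `0 < β < 1 < 14 < |γ|`). -/
theorem summable_tailTerm (T : ℝ) :
    Summable fun ρ : RHWave0.riemannZetaNontrivialZeros =>
      (if T < |(ρ : ℂ).im| then (riemannZetaZeroOrder (ρ : ℂ) : ℝ) / (ρ : ℂ).im ^ 2 else 0) := by
  refine (FordL33.summable_order_div_norm_sq.mul_left 2).of_nonneg_of_le (fun ρ => ?_) (fun ρ => ?_)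
  · split_ifs
    · exact div_nonneg (FordL33.order_pos ρ).le (sq_nonneg _)
    · exact le_rfl
  · have hm := FordL33.order_pos ρ
    have him : 14 < |(ρ : ℂ).im| := FordL33.fourteen_lt_abs_im ρ
    have hre0 := ZetaZeros.riemannZetaNontrivialZeros.re_pos ρ.2
    have hre1 := ZetaZeros.riemannZetaNontrivialZeros.re_lt_one ρ.2
    have h1 : (14 : ℝ) * 14 < |(ρ : ℂ).im| * |(ρ : ℂ).im| := mul_lt_mul'' him him (by norm_num) (by norm_num)
    rw [abs_mul_abs_self] at h1
    have him2 : 196 < (ρ : ℂ).im ^ 2 := by rw [pow_two]; linarith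
    have hnorm : ‖(ρ : ℂ)‖ ^ 2 = (ρ : ℂ).re ^ 2 + (ρ : ℂ).im ^ 2 := by
      rw [Complex.sq_norm, Complex.normSq_apply]; ring
    have hn0 : 0 < ‖(ρ : ℂ)‖ ^ 2 := by rw [hnorm]; nlinarith
    have hn2 : ‖(ρ : ℂ)‖ ^ 2 ≤ 2 * (ρ : ℂ).im ^ 2 := by rw [hnorm]; nlinarith
    split_ifs
    · rw [div_le_iff₀ (by linarith : (0 : ℝ) < (ρ : ℂ).im ^ 2)]
      have key : (riemannZetaZeroOrder (ρ : ℂ) : ℝ) * ‖(ρ : ℂ)‖ ^ 2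
          ≤ 2 * (riemannZetaZeroOrder (ρ : ℂ) : ℝ) * (ρ : ℂ).im ^ 2 := by nlinarith
      calc (riemannZetaZeroOrder (ρ : ℂ) : ℝ)
          = (riemannZetaZeroOrder (ρ : ℂ) : ℝ) * ‖(ρ : ℂ)‖ ^ 2 / ‖(ρ : ℂ)‖ ^ 2 := by
            rw [mul_div_assoc, div_self hn0.ne', mul_one]
        _ ≤ 2 * (riemannZetaZeroOrder (ρ : ℂ) : ℝ) * (ρ : ℂ).im ^ 2 / ‖(ρ : ℂ)‖ ^ 2 :=
            div_le_div_of_nonneg_right key hn0.le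
        _ = 2 * ((riemannZetaZeroOrder (ρ : ℂ) : ℝ) / ‖(ρ : ℂ)‖ ^ 2) * (ρ : ℂ).im ^ 2 := by ring
    · exact mul_nonneg (by norm_num) (div_nonneg hm.le hn0.le)

/-- g4 · a Lehman-type tail bound `Σ_{|Im ρ| > T} m(ρ)/(Im ρ)² ≤ h` (scratch `ZeroTailBound T h`, spelled out; Lehman's
lemma, Brent–Platt–Trudgian 2021 L.1, gives `h(3 000 175 332 800) = 2.96·10⁻¹²` — NOT a tree fact, hypothesis only) gives
the weighted off-line bound `h·√x` at every `x ≥ 1` (`x^(Re ρ − 1/2) ≤ x^(1/2)` because `Re ρ < 1`). -/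
theorem offLineSumAt_of_zeroTailBound {T h x : ℝ}
    (ht : ∑' ρ : RHWave0.riemannZetaNontrivialZeros,
        (if T < |(ρ : ℂ).im| then (riemannZetaZeroOrder (ρ : ℂ) : ℝ) / (ρ : ℂ).im ^ 2 else 0) ≤ h)
    (hx : 1 ≤ x) :
    ∑' ρ : RHWave0.riemannZetaNontrivialZeros,
      (if T < |(ρ : ℂ).im| then
        (riemannZetaZeroOrder (ρ : ℂ) : ℝ) * x ^ ((ρ : ℂ).re - 1 / 2) / (ρ : ℂ).im ^ 2 else 0) ≤ h * √x := by
  have hS := summable_tailTerm T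
  have hx0 : 0 ≤ x := by linarith
  have hle : ∀ ρ : RHWave0.riemannZetaNontrivialZeros,
      (if T < |(ρ : ℂ).im| then
          (riemannZetaZeroOrder (ρ : ℂ) : ℝ) * x ^ ((ρ : ℂ).re - 1 / 2) / (ρ : ℂ).im ^ 2 else 0) ≤
        √x * (if T < |(ρ : ℂ).im| then (riemannZetaZeroOrder (ρ : ℂ) : ℝ) / (ρ : ℂ).im ^ 2 else 0) := by
    intro ρ
    split_ifs with hT
    · have hm := (FordL33.order_pos ρ).le
      have hre1 := (ZetaZeros.riemannZetaNontrivialZeros.re_lt_one ρ.2).le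
      have hpow : x ^ ((ρ : ℂ).re - 1 / 2) ≤ √x := by
        rw [Real.sqrt_eq_rpow]
        exact Real.rpow_le_rpow_of_exponent_le hx (by linarith)
      have h1 : (riemannZetaZeroOrder (ρ : ℂ) : ℝ) * x ^ ((ρ : ℂ).re - 1 / 2) ≤
          (riemannZetaZeroOrder (ρ : ℂ) : ℝ) * √x := mul_le_mul_of_nonneg_left hpow hm
      calc (riemannZetaZeroOrder (ρ : ℂ) : ℝ) * x ^ ((ρ : ℂ).re - 1 / 2) / (ρ : ℂ).im ^ 2
          ≤ (riemannZetaZeroOrder (ρ : ℂ) : ℝ) * √x / (ρ : ℂ).im ^ 2 :=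
            div_le_div_of_nonneg_right h1 (sq_nonneg _)
        _ = √x * ((riemannZetaZeroOrder (ρ : ℂ) : ℝ) / (ρ : ℂ).im ^ 2) := by ring
    · simp
  have hnn : ∀ ρ : RHWave0.riemannZetaNontrivialZeros,
      0 ≤ (if T < |(ρ : ℂ).im| then
          (riemannZetaZeroOrder (ρ : ℂ) : ℝ) * x ^ ((ρ : ℂ).re - 1 / 2) / (ρ : ℂ).im ^ 2 else 0) := by
    intro ρ
    split_ifs
    · exact div_nonneg (mul_nonneg (FordL33.order_pos ρ).le (Real.rpow_nonneg hx0 _)) (sq_nonneg _)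
    · exact le_rfl
  have hS' := (hS.mul_left (√x)).of_nonneg_of_le hnn hle
  calc ∑' ρ : RHWave0.riemannZetaNontrivialZeros,
        (if T < |(ρ : ℂ).im| then
          (riemannZetaZeroOrder (ρ : ℂ) : ℝ) * x ^ ((ρ : ℂ).re - 1 / 2) / (ρ : ℂ).im ^ 2 else 0)
      ≤ ∑' ρ : RHWave0.riemannZetaNontrivialZeros,
          √x * (if T < |(ρ : ℂ).im| then (riemannZetaZeroOrder (ρ : ℂ) : ℝ) / (ρ : ℂ).im ^ 2 else 0) :=
        hS'.tsum_le_tsum hle (hS.mul_left _)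
    _ = √x * ∑' ρ : RHWave0.riemannZetaNontrivialZeros,
          (if T < |(ρ : ℂ).im| then (riemannZetaZeroOrder (ρ : ℂ) : ℝ) / (ρ : ℂ).im ^ 2 else 0) :=
        tsum_mul_left
    _ ≤ √x * h := mul_le_mul_of_nonneg_left ht (Real.sqrt_nonneg x)
    _ = h * √x := mul_comm _ _

/-- g5 · **E1c⁻ ⟹ windowed E1, PROVED** (scratch `E1c.partialNicolasBetween_holds : OffLineSumOn T X₀ X₁ D → … →
PartialNicolasBetween T B (budgetPw D X₀) X₀ X₁`, spelled out): the off-line bound `D` uniformly on a window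
`[X₀, X₁] ⊆ [599, B]` gives, under RH up to `T` and the `θ`-window on `[599, B]`, Nicolas's lower bound with the one budget
`0.0463 + 2(1 + 2/log X₀)D` on `[X₀, X₁]` — modulo the two RH-free `θ`-facts. -/
theorem partialNicolasBetween_holds (hB : Buthe2018_thm2_theta) (hK : BroadbentEtAl2021_theta_rel_1e19)
    {T B D X₀ X₁ : ℝ}
    (hoff : ∀ x : ℝ, X₀ ≤ x → x ≤ X₁ →
      ∑' ρ : RHWave0.riemannZetaNontrivialZeros,
        (if T < |(ρ : ℂ).im| then
          (riemannZetaZeroOrder (ρ : ℂ) : ℝ) * x ^ ((ρ : ℂ).re - 1 / 2) / (ρ : ℂ).im ^ 2 else 0) ≤ D)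
    (hD : 0 ≤ D) (hX₀ : 1 < X₀) (hBB : X₁ ≤ B) :
    RiemannHypothesisUpTo T → (∀ y : ℝ, 599 ≤ y → y ≤ B → |θ y - y| ≤ √y * Real.log y ^ 2 / (8 * π)) →
      ∀ x : ℝ, 599 ≤ x → X₀ ≤ x → x ≤ X₁ →
        -Real.log (nicolasF x) ≤ RobinAnalyticSharp.nicolasERH x +
            (0.0463 + 2 * (1 + 2 / Real.log X₀) * D - nicolasBeta) * (1 / (√x * Real.log x) + 1 / (√x * Real.log x ^ 2) + 4 / (√x * Real.log x ^ 3)) := by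
  intro hT hθ x hx hx0 hx1
  have h := corePwLower hB hK T x D hx hD hT (fun y hy hyx => hθ y hy (le_trans hyx (le_trans hx1 hBB))) (hoff x hx0 hx1)
  exact h.trans (nicolasEWith_mono (by linarith) (budgetPw_anti hD hX₀ hx0))

/-- g5 · **E1c⁻ ∧ (tail bound) ⟹ windowed E1, PROVED** (scratch `E1c.partialNicolasBetween_of_tail`, spelled out): a
Lehman-type tail bound `Σ_{|γ|>T} m/γ² ≤ h` gives the budget `0.0463 + 2(1 + 2/log X₀)·h·√X₁` on `[X₀, X₁]`. -/
theorem partialNicolasBetween_of_tail (hB : Buthe2018_thm2_theta) (hK : BroadbentEtAl2021_theta_rel_1e19)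
    {T B h X₀ X₁ : ℝ}
    (ht : ∑' ρ : RHWave0.riemannZetaNontrivialZeros,
        (if T < |(ρ : ℂ).im| then (riemannZetaZeroOrder (ρ : ℂ) : ℝ) / (ρ : ℂ).im ^ 2 else 0) ≤ h)
    (hh : 0 ≤ h) (hX₀ : 1 < X₀) (hBB : X₁ ≤ B) :
    RiemannHypothesisUpTo T → (∀ y : ℝ, 599 ≤ y → y ≤ B → |θ y - y| ≤ √y * Real.log y ^ 2 / (8 * π)) →
      ∀ x : ℝ, 599 ≤ x → X₀ ≤ x → x ≤ X₁ →
        -Real.log (nicolasF x) ≤ RobinAnalyticSharp.nicolasERH x +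
            (0.0463 + 2 * (1 + 2 / Real.log X₀) * (h * √X₁) - nicolasBeta) * (1 / (√x * Real.log x) + 1 / (√x * Real.log x ^ 2) + 4 / (√x * Real.log x ^ 3)) := by
  refine partialNicolasBetween_holds hB hK (fun x hx0 hx1 => ?_) (by positivity) hX₀ hBB
  have hx1' : 1 ≤ x := by linarith
  exact le_trans (offLineSumAt_of_zeroTailBound ht hx1') (mul_le_mul_of_nonneg_left (Real.sqrt_le_sqrt hx1) hh)

/-- g5 · **E1 ∧ E2 at the Platt–Trudgian height, PROVED modulo RH-free named facts** (scratch
`E1c.nicolasLowerBetween_PT`, spelled out): RH verified to `3 000 175 332 800` and a tail bound `h` at that height give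
Nicolas's lower bound (2.18) with budget `0.0463 + 2(1 + 2/log X₀)·h·√X₁` at every `x ∈ [X₀, X₁]`, `599 ≤ x`,
`X₁ ≤ 2.169·10²⁵` — NO window hypothesis left.  With Lehman's `h(3·10¹²) = 2.96·10⁻¹²` (BPT 2021, L.1; not a tree fact):
budget `≤ 0.147` (g4's tolerance on `[10¹², X₁)`) up to `X₁ ≈ 2.5·10²⁰`. -/
theorem nicolasLowerBetween_PT (h16 : Buthe2016_thm2) (hB : Buthe2018_thm2_theta)
    (hK : BroadbentEtAl2021_theta_rel_1e19) (hRH : RiemannHypothesisUpTo 3000175332800)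
    {h X₀ X₁ : ℝ}
    (ht : ∑' ρ : RHWave0.riemannZetaNontrivialZeros,
        (if 3000175332800 < |(ρ : ℂ).im| then (riemannZetaZeroOrder (ρ : ℂ) : ℝ) / (ρ : ℂ).im ^ 2 else 0) ≤ h)
    (hh : 0 ≤ h) (hX₀ : 1 < X₀) (hX₁ : X₁ ≤ 2.169e25) :
    ∀ x : ℝ, 599 ≤ x → X₀ ≤ x → x ≤ X₁ →
      -Real.log (nicolasF x) ≤ RobinAnalyticSharp.nicolasERH x +
          (0.0463 + 2 * (1 + 2 / Real.log X₀) * (h * √X₁) - nicolasBeta) * (1 / (√x * Real.log x) + 1 / (√x * Real.log x ^ 2) + 4 / (√x * Real.log x ^ 3)) :=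
  partialNicolasBetween_of_tail hB hK ht hh hX₀ hX₁ hRH (schoenfeldThetaOn_of_buthe2016 h16 hRH le_rfl)

end Summit.RiemannHypothesis.RiemannHypothesis.Theorems.Splittings.RobinFiniteE1c

end
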